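import Mathlib
import Summits.QuantumFields.YangMills.Theorems.SpecificationCompactnessFibreRatioKernel
import Literature.MathematicalPhysics.QuantumFieldTheory.Balaban1983to89.T3UnitLawDensityEML
import HarnessLib

/-!
# Route `SpecificationCompactness` (LINE 14 «tail_trivial_kernel», crux `SpecificationLimitAE`, stmt-QuantumFields-22688): what the
# non-degeneracy stub `stub_limitNondegenerate` really asks — ANY in-measure limit `q` of the single-link conditional densities has fibre
# mass `E_{π₀}[q | links ≠ e] ≤ 1` (conditional Fatou, free), and it is fibre-NORMALISED iff its total mass is `∫ q dπ₀ = 1`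

Cell `ym-idea-1` width seat `ym-line-sfw-p2-w3` gen 27 (free hands), continuing the one-link fibre kernel
(`SpecificationCompactnessFibreRatioKernel`, p649054).  The LINE-14 skeleton «link_ratio_ae» (planner ym-idea-5 g10) reduces the deciding crux
to `stub_linkRatioLimitAE` (existence of an in-measure limit `q_e` of `p_{K,e} = ρ̂_K/E_{π₀}[ρ̂_K | links ≠ e]`) and `stub_limitNondegenerate`
(any such limit is a.e. positive AND fibre-normalised, `E_{π₀}[q_e | links ≠ e] = 1` a.e.).  THIS FILE splits the normalisation clause:
* §1 (generic, any finite product `(ι → G, ⊗η)`): `condExp_limit_le_one` — if non-negative integrable densities `u_K` have conditional densities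
  `u_K/E[u_K | ≠e]` converging IN MEASURE to a measurable `q ≥ 0`, then `E[q | ≠e] ≤ 1` a.e. (an a.e.-convergent subsequence, transport to a.e.
  fibre by the kernel's `ae_ae_update_notMem`, Fatou along the fibre, and `∫ p_K(W[e↦a]) dη(a) ∈ {0,1}` exactly because `E[u_K | ≠e]` does not
  see the link `e`); `condExp_limit_eq_one_of_integral_eq_one` — if moreover `∫ q d(⊗η) = 1` then `E[q | ≠e] = 1` a.e. (`∫ E[q|≠e] = ∫ q` and
  `integral_eq_iff_of_ae_le`).  So the normalisation half of the stub is EXACTLY «no loss of mass, ∫ q_e dπ₀ = 1» (uniform integrability of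
  `(p_{K,e})_K`), and nothing conditional.
* §2 (route vocabulary): `limitCondExp_le_one` / `limitNormalised_of_integral_eq_one` for `π₀ = fieldMeasure`, `ρ̂_K = unitDensity F γ K`
  (`unitDensity_props`) and the links-`≠ e` σ-algebra of the route file, with the stub's own hypotheses (`Measurable qe`, `0 ≤ qe`,
  `TendstoInMeasure`).
HONEST FRAMING: measure theory only; rung R3 RECORD line (leaf `YM3TorusSU2`, not Clay); the a.e.-POSITIVITY half and the mass identity
`∫ q_e dπ₀ = 1` are the Bałaban-facing content and stay open; no crux, route, rung or mass gap is proved.  Sources: O. Kallenberg, *Foundations of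
Modern Probability* (2002), Thm 6.4 (disintegration), Lemma 1.13; Fatou's lemma.
-/

noncomputable section

namespace Summit.QuantumFields.YangMills.Theorems.SpecificationCompactnessFibreLimitMass

open MeasureTheory Filter Topology Function Set
open Summit.QuantumFields.YangMills.Theorems.GibbsLimitUniqueness (condExp_pi_ae_eq_integral_update)
open Summit.QuantumFields.YangMills.Theorems.SpecificationCompactnessFibreRatioKernel
  (apply_update_eq_of_measurable_comap ae_ae_update_notMem)

/-! ## §1 Generic: in-measure limits of single-link conditional densities have conditional mass ≤ 1; = 1 iff total mass 1 -/

section Product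

variable {ι : Type*} [Fintype ι] [DecidableEq ι] {G : Type*} [MeasurableSpace G] (η : Measure G) [IsProbabilityMeasure η] (e : ι)

/-- **CONDITIONAL FATOU FOR SINGLE-LINK CONDITIONAL DENSITIES.**  On `(ι → G, ⊗_ι η)` with the links-`≠ e` σ-algebra `m`, let `u_K ≥ 0` be
integrable and let the conditional densities `u_K / E[u_K | m]` converge IN MEASURE to a measurable `q ≥ 0`.  Then `E[q | m] ≤ 1` a.e.: along an
a.e.-convergent subsequence and on a.e. fibre, `∫ q(W[e↦a]) dη ≤ liminf ∫ u_K(W[e↦a])/E[u_K|m](W[e↦a]) dη` (Fatou) and the latter integrals are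
`1` or `0`, because `E[u_K | m]` does not depend on the link `e` and equals the fibre integral of `u_K`. [cite: Kallenberg2002, Thm 6.4] -/
theorem condExp_limit_le_one (u : ℕ → (ι → G) → ℝ) (hum : ∀ K, Measurable (u K)) (hu0 : ∀ K W, 0 ≤ u K W)
    (hui : ∀ K, Integrable (u K) (Measure.pi fun _ : ι => η))
    (q : (ι → G) → ℝ) (hqm : Measurable q) (hq0 : ∀ W, 0 ≤ q W)
    (hlim : TendstoInMeasure (Measure.pi fun _ : ι => η)
      (fun K W => u K W / ((Measure.pi fun _ : ι => η)[u K |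
        MeasurableSpace.comap (fun (W : ι → G) (b : {b // b ≠ e}) => W b.1) MeasurableSpace.pi]) W) atTop q) :
    ∀ᵐ W ∂(Measure.pi fun _ : ι => η),
      ((Measure.pi fun _ : ι => η)[q | MeasurableSpace.comap (fun (W : ι → G) (b : {b // b ≠ e}) => W b.1) MeasurableSpace.pi]) W ≤ 1 := by
  have hm : MeasurableSpace.comap (fun (W : ι → G) (b : {b // b ≠ e}) => W b.1) MeasurableSpace.pi ≤
      (MeasurableSpace.pi : MeasurableSpace (ι → G)) :=
    Measurable.comap_le (measurable_pi_lambda _ fun b => measurable_pi_apply (X := fun _ : ι => G) b.1)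
  by_cases hqi : Integrable q (Measure.pi fun _ : ι => η)
  swap
  · rw [condExp_of_not_integrable hqi]
    exact Eventually.of_forall fun _ => zero_le_one
  obtain ⟨ns, -, hae⟩ := hlim.exists_seq_tendsto_ae
  set c : ℕ → (ι → G) → ℝ := fun K => (Measure.pi fun _ : ι => η)[u K |
    MeasurableSpace.comap (fun (W : ι → G) (b : {b // b ≠ e}) => W b.1) MeasurableSpace.pi] with hcdef
  have hcm : ∀ K, Measurable[MeasurableSpace.comap (fun (W : ι → G) (b : {b // b ≠ e}) => W b.1) MeasurableSpace.pi] (c K) :=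
    fun K => stronglyMeasurable_condExp.measurable
  have hcm0 : ∀ K, Measurable (c K) := fun K => (stronglyMeasurable_condExp.mono hm).measurable
  have hfibu : ∀ᵐ W ∂(Measure.pi fun _ : ι => η), ∀ K, c K W = ∫ a, u K (update W e a) ∂η := by
    rw [ae_all_iff]
    intro K
    exact condExp_pi_ae_eq_integral_update η e (hum K).stronglyMeasurable (hui K)
  have hfibq := condExp_pi_ae_eq_integral_update η e hqm.stronglyMeasurable hqi
  -- transport the a.e. convergence and the fibre formulas to almost every fibre
  have hN : (Measure.pi fun _ : ι => η) {W | ¬ (Tendsto (fun i => u (ns i) W / c (ns i) W) atTop (𝓝 (q W)) ∧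
      ∀ K, c K W = ∫ a, u K (update W e a) ∂η)} = 0 := by
    rw [← ae_iff]
    filter_upwards [hae, hfibu] with W h1 h2 using ⟨h1, h2⟩
  have hfib := ae_ae_update_notMem η e hN
  filter_upwards [hfibq, hfib, hfibu] with W h1 h2 h3
  rw [h1]
  have h2' : ∀ᵐ a ∂η, Tendsto (fun i => u (ns i) (update W e a) / c (ns i) (update W e a)) atTop (𝓝 (q (update W e a))) := by
    filter_upwards [h2] with a ha
    exact (not_not.mp ha).1
  -- the fibre integrals of the conditional densities are `1` or `0`
  have hmeas : ∀ i, Measurable fun a => ENNReal.ofReal (u (ns i) (update W e a) / c (ns i) (update W e a)) := fun i =>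
    (((hum _).comp (measurable_update W)).div ((hcm0 _).comp (measurable_update W))).ennreal_ofReal
  have hstep : ∀ i, ∫⁻ a, ENNReal.ofReal (u (ns i) (update W e a) / c (ns i) (update W e a)) ∂η ≤ 1 := by
    intro i
    have hinv : ∀ a, c (ns i) (update W e a) = c (ns i) W := fun a =>
      apply_update_eq_of_measurable_comap e (hcm _) W a
    simp_rw [hinv]
    by_cases hc : c (ns i) W = 0
    · simp [hc]
    · have hcpos : 0 < c (ns i) W :=
        lt_of_le_of_ne (by rw [h3]; exact integral_nonneg fun a => hu0 _ _) (Ne.symm hc)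
      have hint : Integrable (fun a => u (ns i) (update W e a)) η := by
        by_contra hni
        apply hc
        rw [h3, integral_undef hni]
      rw [← ofReal_integral_eq_lintegral_ofReal (hint.div_const _)
        (ae_of_all _ fun a => div_nonneg (hu0 _ _) hcpos.le), integral_div, ← h3, div_self hc, ENNReal.ofReal_one]
  -- Fatou along the fibre
  have key : ∫⁻ a, ENNReal.ofReal (q (update W e a)) ∂η ≤ 1 := by
    have hF := lintegral_liminf_le (μ := η) (u := atTop)
      (f := fun i a => ENNReal.ofReal (u (ns i) (update W e a) / c (ns i) (update W e a))) hmeas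
    have hlim_ae : (fun a => ENNReal.ofReal (q (update W e a))) =ᵐ[η]
        fun a => liminf (fun i => ENNReal.ofReal (u (ns i) (update W e a) / c (ns i) (update W e a))) atTop := by
      filter_upwards [h2'] with a ha
      exact ((ENNReal.continuous_ofReal.tendsto _).comp ha).liminf_eq.symm
    rw [lintegral_congr_ae hlim_ae]
    exact hF.trans (liminf_le_of_frequently_le' ((Eventually.of_forall hstep).frequently))
  by_cases hqf : Integrable (fun a => q (update W e a)) η
  · rw [integral_eq_lintegral_of_nonneg_ae (ae_of_all _ fun a => hq0 _) hqf.aestronglyMeasurable]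
    exact ENNReal.toReal_le_of_le_ofReal zero_le_one (by rwa [ENNReal.ofReal_one])
  · rw [integral_undef hqf]
    exact zero_le_one

/-- **NORMALISATION ⇔ NO LOSS OF MASS.**  In the situation of `condExp_limit_le_one`, if moreover `∫ q d(⊗η) = 1` then the limit specification is
fibre-normalised: `E[q | m] = 1` a.e. (`∫ E[q|m] = ∫ q = 1 = ∫ 1` and `E[q|m] ≤ 1` a.e.). [cite: Kallenberg2002, Thm 6.4] -/
theorem condExp_limit_eq_one_of_integral_eq_one (u : ℕ → (ι → G) → ℝ) (hum : ∀ K, Measurable (u K)) (hu0 : ∀ K W, 0 ≤ u K W)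
    (hui : ∀ K, Integrable (u K) (Measure.pi fun _ : ι => η))
    (q : (ι → G) → ℝ) (hqm : Measurable q) (hq0 : ∀ W, 0 ≤ q W)
    (hq1 : ∫ W, q W ∂(Measure.pi fun _ : ι => η) = 1)
    (hlim : TendstoInMeasure (Measure.pi fun _ : ι => η)
      (fun K W => u K W / ((Measure.pi fun _ : ι => η)[u K |
        MeasurableSpace.comap (fun (W : ι → G) (b : {b // b ≠ e}) => W b.1) MeasurableSpace.pi]) W) atTop q) :
    ∀ᵐ W ∂(Measure.pi fun _ : ι => η),
      ((Measure.pi fun _ : ι => η)[q | MeasurableSpace.comap (fun (W : ι → G) (b : {b // b ≠ e}) => W b.1) MeasurableSpace.pi]) W = 1 := by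
  have hm : MeasurableSpace.comap (fun (W : ι → G) (b : {b // b ≠ e}) => W b.1) MeasurableSpace.pi ≤
      (MeasurableSpace.pi : MeasurableSpace (ι → G)) :=
    Measurable.comap_le (measurable_pi_lambda _ fun b => measurable_pi_apply (X := fun _ : ι => G) b.1)
  have hle := condExp_limit_le_one η e u hum hu0 hui q hqm hq0 hlim
  have hint : ∫ W, ((Measure.pi fun _ : ι => η)[q |
      MeasurableSpace.comap (fun (W : ι → G) (b : {b // b ≠ e}) => W b.1) MeasurableSpace.pi]) W ∂(Measure.pi fun _ : ι => η) =
      ∫ _W, (1 : ℝ) ∂(Measure.pi fun _ : ι => η) := by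
    rw [integral_condExp hm, hq1]
    simp
  exact (integral_eq_iff_of_ae_le integrable_condExp (integrable_const _) hle).mp hint

end Product

/-! ## §2 The route's vocabulary: in-measure limits of `p_{K,e} = ρ̂_K / E_{π₀}[ρ̂_K | links ≠ e]` -/

section YM

open scoped Classical
open Literature.MathematicalPhysics.QuantumFieldTheory.Balaban1983to89
open Literature.MathematicalPhysics.QuantumFieldTheory.Balaban1983to89.T3ContinuumYM3Torus
open Literature.MathematicalPhysics.QuantumFieldTheory.Balaban1983to89.T3UnitLawDensityEML

/-- **ANY IN-MEASURE LIMIT OF THE CANONICAL LINK RATIOS HAS CONDITIONAL MASS ≤ 1** (the free half of `stub_limitNondegenerate` of the line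
«link_ratio_ae» on `SpecificationLimitAE`, stmt-QuantumFields-22688): for Bałaban's renormalised unit densities `ρ̂_K = unitDensity F γ K`
(`γ > 0`), a unit link `e`, and a measurable `qe ≥ 0` with `p_{K,e} → qe` in `π₀`-measure, `E_{π₀}[qe | links ≠ e] ≤ 1` `π₀`-a.e.
[cite: Kallenberg2002, Thm 6.4] -/
theorem limitCondExp_le_one (F : T3Family) (γ : ℝ) (hγ : 0 < γ) (e : PBond (F.P 0) 0)
    (qe : GaugeField (F.P 0) 0 (Matrix.specialUnitaryGroup (Fin 2) ℂ) → ℝ) (hqm : Measurable qe) (hq0 : ∀ V, 0 ≤ qe V)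
    (hlim : TendstoInMeasure (fieldMeasure (F.P 0) 0 (Matrix.specialUnitaryGroup (Fin 2) ℂ))
      (fun (K : ℕ) (V : GaugeField (F.P 0) 0 (Matrix.specialUnitaryGroup (Fin 2) ℂ)) =>
        unitDensity F γ K V /
          condExp (MeasurableSpace.comap (fun (W : GaugeField (F.P 0) 0 (Matrix.specialUnitaryGroup (Fin 2) ℂ))
            (b : {b : PBond (F.P 0) 0 // b ≠ e}) => W b.1) MeasurableSpace.pi)
            (fieldMeasure (F.P 0) 0 (Matrix.specialUnitaryGroup (Fin 2) ℂ)) (unitDensity F γ K) V) atTop qe) :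
    ∀ᵐ V ∂(fieldMeasure (F.P 0) 0 (Matrix.specialUnitaryGroup (Fin 2) ℂ)),
      condExp (MeasurableSpace.comap (fun (W : GaugeField (F.P 0) 0 (Matrix.specialUnitaryGroup (Fin 2) ℂ))
        (b : {b : PBond (F.P 0) 0 // b ≠ e}) => W b.1) MeasurableSpace.pi)
        (fieldMeasure (F.P 0) 0 (Matrix.specialUnitaryGroup (Fin 2) ℂ)) qe V ≤ 1 := by
  haveI hηP : IsProbabilityMeasure (HaarData.haar : Measure (Matrix.specialUnitaryGroup (Fin 2) ℂ)) := HaarData.isProb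
  have hu := fun K => unitDensity_props F K hγ.le
  exact condExp_limit_le_one (HaarData.haar : Measure (Matrix.specialUnitaryGroup (Fin 2) ℂ)) e (fun K => unitDensity F γ K)
    (fun K => (hu K).1) (fun K => (hu K).2.1) (fun K => (hu K).2.2) qe hqm hq0 hlim

/-- **… AND IT IS FIBRE-NORMALISED AS SOON AS ITS TOTAL MASS IS ONE**: with `∫ qe dπ₀ = 1` (no loss of mass along the cut-off — uniform
integrability of `(p_{K,e})_K`), `E_{π₀}[qe | links ≠ e] = 1` `π₀`-a.e., i.e. the normalisation clause of `stub_limitNondegenerate` /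
`SpecificationLimitAE`. [cite: Kallenberg2002, Thm 6.4] -/
theorem limitNormalised_of_integral_eq_one (F : T3Family) (γ : ℝ) (hγ : 0 < γ) (e : PBond (F.P 0) 0)
    (qe : GaugeField (F.P 0) 0 (Matrix.specialUnitaryGroup (Fin 2) ℂ) → ℝ) (hqm : Measurable qe) (hq0 : ∀ V, 0 ≤ qe V)
    (hq1 : ∫ V, qe V ∂(fieldMeasure (F.P 0) 0 (Matrix.specialUnitaryGroup (Fin 2) ℂ)) = 1)
    (hlim : TendstoInMeasure (fieldMeasure (F.P 0) 0 (Matrix.specialUnitaryGroup (Fin 2) ℂ))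
      (fun (K : ℕ) (V : GaugeField (F.P 0) 0 (Matrix.specialUnitaryGroup (Fin 2) ℂ)) =>
        unitDensity F γ K V /
          condExp (MeasurableSpace.comap (fun (W : GaugeField (F.P 0) 0 (Matrix.specialUnitaryGroup (Fin 2) ℂ))
            (b : {b : PBond (F.P 0) 0 // b ≠ e}) => W b.1) MeasurableSpace.pi)
            (fieldMeasure (F.P 0) 0 (Matrix.specialUnitaryGroup (Fin 2) ℂ)) (unitDensity F γ K) V) atTop qe) :
    ∀ᵐ V ∂(fieldMeasure (F.P 0) 0 (Matrix.specialUnitaryGroup (Fin 2) ℂ)),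
      condExp (MeasurableSpace.comap (fun (W : GaugeField (F.P 0) 0 (Matrix.specialUnitaryGroup (Fin 2) ℂ))
        (b : {b : PBond (F.P 0) 0 // b ≠ e}) => W b.1) MeasurableSpace.pi)
        (fieldMeasure (F.P 0) 0 (Matrix.specialUnitaryGroup (Fin 2) ℂ)) qe V = 1 := by
  haveI hηP : IsProbabilityMeasure (HaarData.haar : Measure (Matrix.specialUnitaryGroup (Fin 2) ℂ)) := HaarData.isProb
  have hu := fun K => unitDensity_props F K hγ.le
  exact condExp_limit_eq_one_of_integral_eq_one (HaarData.haar : Measure (Matrix.specialUnitaryGroup (Fin 2) ℂ)) e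
    (fun K => unitDensity F γ K) (fun K => (hu K).1) (fun K => (hu K).2.1) (fun K => (hu K).2.2) qe hqm hq0 hq1 hlim

end YM

end Summit.QuantumFields.YangMills.Theorems.SpecificationCompactnessFibreLimitMass

end
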